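/-
Origin: written from primary sources — S. Kudla, *Seesaw dual reductive pairs* (1984) §1 (a see-saw partner need not
sit in block position: for a hermitian plane `W` and a second orthogonal decomposition `W = W₃ ⊕ W₄` the torus
`U(W₃) × U(W₄)` is the conjugate `g (U(W₃) × U(W₄)) g⁻¹ ⊂ U(W)` of a block-diagonal torus by a rational isometry
`g : (W, J₃ ⊕ J₄) ≅ (W, J_W)`); R. Howe, *θ-series and invariant theory* (1979) §2–§3; S. Gelbart, J. Rogawski,
Invent. Math. 105 (1991) §3.1 Prop. 3.1.1 p. 455, Remark p. 457; A. Weil, Acta Math. 111 (1964) Chap. III n° 40–41,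
Thm 6 p. 193 (the rational symplectic element moving the torus lifts to a `Θ`-fixing metaplectic operator
`r_F(h₀)`). Adapted: no. This file is the JUNCTION, at the splitting data OF RECORD, of unitary-2's adelic see-saw
element and square (`UnitaryGroupSeesawConjugation.adelicSeesawConj`, `_conj`, `_mem_range`), Weil's rational lift
(`AdelicMetaplecticSeesawConjugate.ratConjSplitting`), and the see-saw character along `finProdSumEquiv`
(`AdelicMetaplecticSeesawSum`, `UnitaryDualPairSeesawCharacter`). Kernel only; no records; compatibility of the
three splittings ([GelbartRogawski1991, Prop. 3.1.1]) is a hypothesis, never asserted.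
-/
import Literature.NumberTheory.GelbartRogawski1991.UnitaryDualPairSeesawCharacter
import Literature.NumberTheory.Weil1964.AdelicMetaplecticSeesawConjugate
import Literature.NumberTheory.Automorphic.UnitaryGroupSeesawConjugation
import HarnessLib

-- buildfix G11b-3 recipe (LEDGER B13-1/B13-3): elaborate sequentially so the trailing `attribute [implicit_reducible]`
-- block (reducibilityCoreExt is keyed to the async environment branch) is in force at `.olean` export.
set_option Elab.async false

/-!
# The see-saw character of a CONJUGATED torus `g (U(W₃) × U(W₄)) g⁻¹ ⊂ U(W)` at the splitting data of record

Setting: as in `UnitaryDualPairSeesawCharacter`, plus a big pair `(U(J_V), U(J_W))`, `J_W = T_W ⊗ 1`, `T_W ∈ GL_M(F)`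
symmetric, `M = M₁ + M₂` (index type `Fin (M₁ + M₂)`), with a compatible splitting `s` over the Gram matrix of record
`adelicGram e_W T_V T_W`, and unitary-2's SEE-SAW DATA moving the block-diagonal torus of `J₁ ⊕ᶠ J₂` into `U(J_W)`:
an adelic isometry `g ∈ GL_M(𝔸_E)`, `(c g)ᵀ (J_W ⊗ 1) g = (J₁ ⊕ᶠ J₂) ⊗ 1` (`hg`) which is rational, `g = g₀ ⊗ 1` (`hgg₀`,
`hg₀`), and a rational relabelling `C = C₀ ⊗ 1` with `(T_V ⊗ T_W ⊗ 1) C = T_V ⊗ (T₁ ⊕ᶠ T₂) ⊗ 1` (`hC`, `hCC₀`).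

* §1 `seesawBigConj s g hg : P →* Mp_ψ(W_{T_V ⊗ T_W})ᶜᵒⁿᵗ`, `P = U(J_V)(𝔸) × (U(J₁)(𝔸) × U(J₂)(𝔸))`,
  `(v, (u₁, u₂)) ↦ reindex_{e_W}⁻¹ s_pair(v, g (u₁ ⊕ᶠ u₂) g⁻¹)`; `proj_seesawBigConj` (`= ι_{V,W}(v ⊗ g (u₁ ⊕ᶠ u₂) g⁻¹)`);
  rational points: `adelicIsometryConj_toAdelic` (`g γ g⁻¹` is rational for rational `γ`), `coe_seesawBigConj_mem_adelicMpTheta`;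
* §2 `seesawConjSplitting … := ratConjSplitting … hT h₀ hrat C hC (seesawBigConj s g hg) : P →* Mp_ψ(W_{T_V ⊗ (T₁ ⊕ᶠ T₂)})ᶜᵒⁿᵗ`
  with `h₀ := adelicSeesawConj …`, `hrat := adelicSeesawConj_mem_range …`; **`proj_seesawConjSplitting`**:
  `π(seesawConjSplitting p) = ι_{V,W₁ ⊕ W₂}(v ⊗ (u₁ ⊕ᶠ u₂))` (the seam lemma `proj_ratConjSplitting_eq` fed with
  `adelicSeesawConj_conj`); `Θ`-fixing at rational points; **`hS_seesawConj`** (= `adelicPairToSymplectic_dualPair_adelicBlockDiag`);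
* §3 **`mpSeesawChar₃₄ … : P →* ℂˣ`** := `mpSeesawCharSum (finProdSumEquiv N M₁ M₂) _ (seesawConjSplitting …) (seesawSmall₁ s₁) (seesawSmall₂ s₂) …`,
  `mpSeesawChar₃₄_def`, the transported identity `mpSeesawChar₃₄_spec_transported`, **THE IDENTITY IN THE BIG PAIR'S OWN
  MODEL** `mpSeesawChar₃₄_spec`:
  `ω(seesawBigConj p) (ω(r_F h₀) (sumTensor Φ₁ Φ₂)) = χ₃₄(p) • ω(r_F h₀) (sumTensor (ω(seesawSmall₁ s₁ p) Φ₁) (ω(seesawSmall₂ s₂ p) Φ₂))`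
  — the restriction of the big oscillator representation to the conjugated torus is the tensor of the small ones along
  the transported tensor `R = ω(r_F h₀) ∘ R_e⁻¹ ∘ ⊠`, up to `χ₃₄`; and **`mpSeesawChar₃₄_eq_one_of_rational`**: `χ₃₄ = 1` on
  `U(J_V)(F) × (U(J₁)(F) × U(J₂)(F))`.

Provenance / use (Hodge-CM model-construction cell, node W2-⊗ «(34)-transport», rows `gen12`/`real34`): this is the
`(34)` analogue of `UnitaryDualPairSeesawCharacter.mpSeesawChar₁₂` — the `RestrictTmul` identity of the package's
`ThetaSeesawData` for PerL's second torus of the hermitian plane, at the CONSTRUCTED adelic Weil representations, up to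
the automorphic character `χ₃₄` (absorbed by the λ-renormalisation of the `(34)` small pairs). In practice `hg` is
`UnitaryGroupSeesawConjugation.isometry_map_adele hg₀` rewritten by `adelicForm_eq_map_map`; it is kept as a
hypothesis to stay in unitary-2's currency. No continuity claim for `χ₃₄` (conjugation by `ω(r_F h₀)` is not
coefficient-continuous). What is NOT proved: `χ₃₄ = 1` identically, nor any comparison `χ₃₄ = χ₁₂`.
-/

set_option autoImplicit false

noncomputable section

open scoped Matrix Kronecker
open NumberField
open Literature.RepresentationTheory.HeisenbergGroup
open Literature.RepresentationTheory.HeisenbergGroup.SymplecticMatrix (transportSp mapHom)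
open Literature.NumberTheory.Automorphic
open Literature.NumberTheory.Automorphic.UnitaryGroup
open Literature.NumberTheory.Weil1964

namespace Literature.NumberTheory.GelbartRogawski1991

namespace UnitaryDualPair

/-! ## §1 The big pair splitting on the conjugated torus -/

section BigConj

variable (F E : Type) [Field F] [NumberField F] [Field E] [NumberField E] [Algebra F E]
variable (c : E ≃ₐ[F] E) (N M₁ M₂ : ℕ) {n : ℕ} (eW : Fin N × Fin (M₁ + M₂) ≃ Fin n)
variable (JV : Matrix (Fin N) (Fin N) E) (JW : Matrix (Fin (M₁ + M₂)) (Fin (M₁ + M₂)) E)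
  (J₁ : Matrix (Fin M₁) (Fin M₁) E) (J₂ : Matrix (Fin M₂) (Fin M₂) E)
variable {TV : Matrix (Fin N) (Fin N) F} {TW : Matrix (Fin (M₁ + M₂)) (Fin (M₁ + M₂)) F}
  {T₁ : Matrix (Fin M₁) (Fin M₁) F} {T₂ : Matrix (Fin M₂) (Fin M₂) F}

/-- **The big pair splitting read on the CONJUGATED torus**, Kronecker coordinates `Fin N × Fin (M₁ + M₂)`:
`(v, (u₁, u₂)) ↦ reindex_{e_W}⁻¹ (s_pair(v, g (u₁ ⊕ᶠ u₂) g⁻¹))`. (cf. S. Kudla (1984) §1) [folklore] -/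
def seesawBigConj (s : adelicPair F E c N (M₁ + M₂) JV JW →* adelicMpCont F (Fin n) (adelicGram F eW TV TW))
    (g : GL (Fin (M₁ + M₂)) (AdeleRing (𝓞 E) E))
    (hg : ((g : Matrix (Fin (M₁ + M₂)) (Fin (M₁ + M₂)) (AdeleRing (𝓞 E) E)).map (conjAdele F E c))ᵀ *
        adelicForm E (M₁ + M₂) JW * g = adelicForm E (M₁ + M₂) (finSum M₁ M₂ J₁ J₂)) :
    adelic F E c N JV × (adelic F E c M₁ J₁ × adelic F E c M₂ J₂) →*
      adelicMpCont F (Fin N × Fin (M₁ + M₂))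
        (TV.map (algebraMap F (AdeleRing (𝓞 F) F)) ⊗ₖ TW.map (algebraMap F (AdeleRing (𝓞 F) F))) :=
  ((adelicMpContReindex F eW
      (TV.map (algebraMap F (AdeleRing (𝓞 F) F)) ⊗ₖ TW.map (algebraMap F (AdeleRing (𝓞 F) F)))).symm.toMonoidHom.comp
    (pairSplitting F E c N (M₁ + M₂) eW JV JW s)).comp
    ((MonoidHom.id (adelic F E c N JV)).prodMap
      ((adelicIsometryConj F E c (M₁ + M₂) g hg).comp (adelicBlockDiag F E c M₁ M₂ J₁ J₂)))

/-- Unfolding. [folklore] -/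
theorem seesawBigConj_apply (s : adelicPair F E c N (M₁ + M₂) JV JW →* adelicMpCont F (Fin n) (adelicGram F eW TV TW))
    (g : GL (Fin (M₁ + M₂)) (AdeleRing (𝓞 E) E))
    (hg : ((g : Matrix (Fin (M₁ + M₂)) (Fin (M₁ + M₂)) (AdeleRing (𝓞 E) E)).map (conjAdele F E c))ᵀ *
        adelicForm E (M₁ + M₂) JW * g = adelicForm E (M₁ + M₂) (finSum M₁ M₂ J₁ J₂))
    (p : adelic F E c N JV × (adelic F E c M₁ J₁ × adelic F E c M₂ J₂)) :
    seesawBigConj F E c N M₁ M₂ eW JV JW J₁ J₂ s g hg p =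
      (adelicMpContReindex F eW
        (TV.map (algebraMap F (AdeleRing (𝓞 F) F)) ⊗ₖ TW.map (algebraMap F (AdeleRing (𝓞 F) F)))).symm
        (pairSplitting F E c N (M₁ + M₂) eW JV JW s
          (p.1, adelicIsometryConj F E c (M₁ + M₂) g hg (adelicBlockDiag F E c M₁ M₂ J₁ J₂ p.2))) :=
  rfl

/-- `ω(seesawBigConj s g hg p) Φ = R_{e_W}⁻¹ (ω(s_pair(v, g (u₁ ⊕ᶠ u₂) g⁻¹)) (R_{e_W} Φ))`. [folklore] -/
theorem omega_seesawBigConj_apply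
    (s : adelicPair F E c N (M₁ + M₂) JV JW →* adelicMpCont F (Fin n) (adelicGram F eW TV TW))
    (g : GL (Fin (M₁ + M₂)) (AdeleRing (𝓞 E) E))
    (hg : ((g : Matrix (Fin (M₁ + M₂)) (Fin (M₁ + M₂)) (AdeleRing (𝓞 E) E)).map (conjAdele F E c))ᵀ *
        adelicForm E (M₁ + M₂) JW * g = adelicForm E (M₁ + M₂) (finSum M₁ M₂ J₁ J₂))
    (p : adelic F E c N JV × (adelic F E c M₁ J₁ × adelic F E c M₂ J₂)) (Φ : piSchwartzBruhat F (Fin N × Fin (M₁ + M₂))) :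
    adelicMpCont.omega F (Fin N × Fin (M₁ + M₂))
        (TV.map (algebraMap F (AdeleRing (𝓞 F) F)) ⊗ₖ TW.map (algebraMap F (AdeleRing (𝓞 F) F)))
        (seesawBigConj F E c N M₁ M₂ eW JV JW J₁ J₂ s g hg p) Φ =
      (piSBReindex F eW).symm
        (adelicMpCont.omega F (Fin n) (adelicGram F eW TV TW)
          (pairSplitting F E c N (M₁ + M₂) eW JV JW s
            (p.1, adelicIsometryConj F E c (M₁ + M₂) g hg (adelicBlockDiag F E c M₁ M₂ J₁ J₂ p.2)))
          (piSBReindex F eW Φ)) :=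
  adelicMpCont.omega_reindex_symm_apply F eW _ _ Φ

omit [NumberField F] in
/-- **conjugates of rational points are rational**: for a rational isometry `g = g₀ ⊗ 1`,
`g (γ ⊗ 1) g⁻¹ = (g₀ γ g₀⁻¹) ⊗ 1`. [folklore] -/
theorem adelicIsometryConj_toAdelic {M : ℕ} {JW JW' : Matrix (Fin M) (Fin M) E} (g : GL (Fin M) (AdeleRing (𝓞 E) E))
    (hg : ((g : Matrix (Fin M) (Fin M) (AdeleRing (𝓞 E) E)).map (conjAdele F E c))ᵀ * adelicForm E M JW * g =
      adelicForm E M JW') (g₀ : GL (Fin M) E)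
    (hg₀ : (((g₀ : GL (Fin M) E) : Matrix (Fin M) (Fin M) E).map (c : E →+* E))ᵀ * JW * g₀ = JW')
    (hgg₀ : (g : Matrix (Fin M) (Fin M) (AdeleRing (𝓞 E) E)) =
      ((g₀ : GL (Fin M) E) : Matrix (Fin M) (Fin M) E).map (algebraMap E (AdeleRing (𝓞 E) E)))
    (γ : rational F E c M JW') :
    adelicIsometryConj F E c M g hg (toAdelic F E c M JW' γ) =
      toAdelic F E c M JW (isometryConj (c : E →+* E) g₀ hg₀ γ) := by
  have hgm : g = Matrix.GeneralLinearGroup.map (algebraMap E (AdeleRing (𝓞 E) E)) g₀ := Units.ext hgg₀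
  refine Subtype.ext ?_
  show g * Matrix.GeneralLinearGroup.map (algebraMap E (AdeleRing (𝓞 E) E)) (γ : GL (Fin M) E) * g⁻¹ =
    Matrix.GeneralLinearGroup.map (algebraMap E (AdeleRing (𝓞 E) E)) (g₀ * (γ : GL (Fin M) E) * g₀⁻¹)
  rw [hgm, map_mul, map_mul, map_inv]

omit [NumberField F] in
/-- … hence `g (γ ⊗ 1) g⁻¹ ∈ U(J_W)(F)`. [folklore] -/
theorem adelicIsometryConj_toAdelic_mem_range {M : ℕ} {JW JW' : Matrix (Fin M) (Fin M) E}
    (g : GL (Fin M) (AdeleRing (𝓞 E) E))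
    (hg : ((g : Matrix (Fin M) (Fin M) (AdeleRing (𝓞 E) E)).map (conjAdele F E c))ᵀ * adelicForm E M JW * g =
      adelicForm E M JW') (g₀ : GL (Fin M) E)
    (hg₀ : (((g₀ : GL (Fin M) E) : Matrix (Fin M) (Fin M) E).map (c : E →+* E))ᵀ * JW * g₀ = JW')
    (hgg₀ : (g : Matrix (Fin M) (Fin M) (AdeleRing (𝓞 E) E)) =
      ((g₀ : GL (Fin M) E) : Matrix (Fin M) (Fin M) E).map (algebraMap E (AdeleRing (𝓞 E) E)))
    {u : adelic F E c M JW'} (hu : u ∈ (toAdelic F E c M JW').range) :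
    adelicIsometryConj F E c M g hg u ∈ (toAdelic F E c M JW).range := by
  obtain ⟨γ, rfl⟩ := hu
  exact ⟨isometryConj (c : E →+* E) g₀ hg₀ γ, (adelicIsometryConj_toAdelic F E c g hg g₀ hg₀ hgg₀ γ).symm⟩

variable [Algebra.IsQuadraticExtension F E] {δ : E} (hcδ : c δ = -δ) (hδ : δ ≠ 0) {d : F}
  (hd : δ * δ = algebraMap F E d) (hV : TV.IsSymm) (hW : TW.IsSymm) (hVd : IsUnit TV.det) (hTWd : IsUnit TW.det)
  (hJV : JV = TV.map (algebraMap F E)) (hJW : JW = TW.map (algebraMap F E))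
  {s : adelicPair F E c N (M₁ + M₂) JV JW →* adelicMpCont F (Fin n) (adelicGram F eW TV TW)}
  (g : GL (Fin (M₁ + M₂)) (AdeleRing (𝓞 E) E))
  (hg : ((g : Matrix (Fin (M₁ + M₂)) (Fin (M₁ + M₂)) (AdeleRing (𝓞 E) E)).map (conjAdele F E c))ᵀ *
      adelicForm E (M₁ + M₂) JW * g = adelicForm E (M₁ + M₂) (finSum M₁ M₂ J₁ J₂))

/-- **`π(seesawBigConj s g hg (v, (u₁, u₂))) = ι_{V,W}(v ⊗ g (u₁ ⊕ᶠ u₂) g⁻¹)`** for a compatible `s`.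
[cite: GelbartRogawski1991, §3.1 Prop. 3.1.1 p. 455 L1–3] -/
theorem proj_seesawBigConj
    (hs : (splittingDatum F E c N (M₁ + M₂) eW JV JW hcδ hδ hd hV hW hVd hTWd hJV hJW).IsCompatible s)
    (p : adelic F E c N JV × (adelic F E c M₁ J₁ × adelic F E c M₂ J₂)) :
    adelicMpCont.proj F (Fin N × Fin (M₁ + M₂))
        (TV.map (algebraMap F (AdeleRing (𝓞 F) F)) ⊗ₖ TW.map (algebraMap F (AdeleRing (𝓞 F) F)))
        (seesawBigConj F E c N M₁ M₂ eW JV JW J₁ J₂ s g hg p) =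
      adelicPairToSymplectic F E c N (M₁ + M₂) hcδ hδ hd hV hW hJV hJW
        (dualPair (conjAdele F E c) (adelicForm E N JV) (adelicForm E (M₁ + M₂) JW)
          (p.1, adelicIsometryConj F E c (M₁ + M₂) g hg (adelicBlockDiag F E c M₁ M₂ J₁ J₂ p.2))) :=
  adelicMpCont.proj_reindex_symm_eq F eW _
    ((proj_pairSplitting F E c N (M₁ + M₂) eW JV JW hcδ hδ hd hV hW hVd hTWd hJV hJW hs
        (p.1, adelicIsometryConj F E c (M₁ + M₂) g hg (adelicBlockDiag F E c M₁ M₂ J₁ J₂ p.2))).trans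
      (congrArg (fun x => toSp F E c N (M₁ + M₂) eW JV JW hcδ hδ hd hV hW hJV hJW x)
        (adelicInl_mul_adelicInr F E c N p.1
          (adelicIsometryConj F E c (M₁ + M₂) g hg (adelicBlockDiag F E c M₁ M₂ J₁ J₂ p.2)))))

/-- **`Θ`-fixing at rational points** for the conjugated torus: `v, γ₁, γ₂` rational and `g` rational (`hgg₀`, `hg₀`).
[cite: Weil1964, Chap. III n° 41 Thm 6 p. 193] -/
theorem coe_seesawBigConj_mem_adelicMpTheta
    (hs : (splittingDatum F E c N (M₁ + M₂) eW JV JW hcδ hδ hd hV hW hVd hTWd hJV hJW).IsCompatible s)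
    (g₀ : GL (Fin (M₁ + M₂)) E)
    (hg₀ : (((g₀ : GL (Fin (M₁ + M₂)) E) : Matrix (Fin (M₁ + M₂)) (Fin (M₁ + M₂)) E).map (c : E →+* E))ᵀ * JW * g₀ =
      finSum M₁ M₂ J₁ J₂)
    (hgg₀ : (g : Matrix (Fin (M₁ + M₂)) (Fin (M₁ + M₂)) (AdeleRing (𝓞 E) E)) =
      ((g₀ : GL (Fin (M₁ + M₂)) E) : Matrix (Fin (M₁ + M₂)) (Fin (M₁ + M₂)) E).map (algebraMap E (AdeleRing (𝓞 E) E)))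
    (γV : rational F E c N JV) (γ₁ : rational F E c M₁ J₁) (γ₂ : rational F E c M₂ J₂) :
    ((seesawBigConj F E c N M₁ M₂ eW JV JW J₁ J₂ s g hg
        (toAdelic F E c N JV γV, (toAdelic F E c M₁ J₁ γ₁, toAdelic F E c M₂ J₂ γ₂)) :
        adelicMpCont F (Fin N × Fin (M₁ + M₂))
          (TV.map (algebraMap F (AdeleRing (𝓞 F) F)) ⊗ₖ TW.map (algebraMap F (AdeleRing (𝓞 F) F)))) :
        adelicMp F (Fin N × Fin (M₁ + M₂))
          (TV.map (algebraMap F (AdeleRing (𝓞 F) F)) ⊗ₖ TW.map (algebraMap F (AdeleRing (𝓞 F) F)))) ∈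
      adelicMpTheta F (Fin N × Fin (M₁ + M₂))
        (TV.map (algebraMap F (AdeleRing (𝓞 F) F)) ⊗ₖ TW.map (algebraMap F (AdeleRing (𝓞 F) F))) :=
  (coe_adelicMpContReindex_symm_mem_adelicMpTheta_iff F eW _ _).2
    ((MpPsi.mem_fixing_iff _ _ _).2 fun Φ =>
      thetaDistLM_pairRep_rat F E c N (M₁ + M₂) eW JV JW hcδ hδ hd hV hW hVd hTWd hJV hJW hs ⟨γV, rfl⟩
        (adelicIsometryConj_toAdelic_mem_range F E c g hg g₀ hg₀ hgg₀
          (adelicBlockDiag_toAdelic_mem_range F E c M₁ M₂ J₁ J₂ γ₁ γ₂)) Φ)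

end BigConj

/-! ## §2 Conjugation by Weil's rational lift of the see-saw element, and the see-saw hypothesis -/

section Conj

variable (F E : Type) [Field F] [NumberField F] [Field E] [NumberField E] [Algebra F E]
variable (c : E ≃ₐ[F] E) (N M₁ M₂ : ℕ) {n n₁ n₂ : ℕ} (eW : Fin N × Fin (M₁ + M₂) ≃ Fin n)
  (e₁ : Fin N × Fin M₁ ≃ Fin n₁) (e₂ : Fin N × Fin M₂ ≃ Fin n₂)
variable (JV : Matrix (Fin N) (Fin N) E) (JW : Matrix (Fin (M₁ + M₂)) (Fin (M₁ + M₂)) E)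
  (J₁ : Matrix (Fin M₁) (Fin M₁) E) (J₂ : Matrix (Fin M₂) (Fin M₂) E)
variable {TV : Matrix (Fin N) (Fin N) F} {TW : Matrix (Fin (M₁ + M₂)) (Fin (M₁ + M₂)) F}
  {T₁ : Matrix (Fin M₁) (Fin M₁) F} {T₂ : Matrix (Fin M₂) (Fin M₂) F}
variable [Algebra.IsQuadraticExtension F E] {δ : E} (hcδ : c δ = -δ) (hδ : δ ≠ 0) {d : F}
  (hd : δ * δ = algebraMap F E d) (hV : TV.IsSymm) (hW : TW.IsSymm) (h₁ : T₁.IsSymm) (h₂ : T₂.IsSymm)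
  (hVd : IsUnit TV.det) (hTWd : IsUnit TW.det) (h₁d : IsUnit T₁.det) (h₂d : IsUnit T₂.det)
  (hT : IsUnit (TV.map (algebraMap F (AdeleRing (𝓞 F) F)) ⊗ₖ TW.map (algebraMap F (AdeleRing (𝓞 F) F))).det)
  (hJV : JV = TV.map (algebraMap F E)) (hJW : JW = TW.map (algebraMap F E))
  (hJ₁ : J₁ = T₁.map (algebraMap F E)) (hJ₂ : J₂ = T₂.map (algebraMap F E))
  {s : adelicPair F E c N (M₁ + M₂) JV JW →* adelicMpCont F (Fin n) (adelicGram F eW TV TW)}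
  {s₁ : adelicPair F E c N M₁ JV J₁ →* adelicMpCont F (Fin n₁) (adelicGram F e₁ TV T₁)}
  {s₂ : adelicPair F E c N M₂ JV J₂ →* adelicMpCont F (Fin n₂) (adelicGram F e₂ TV T₂)}
  {g : GL (Fin (M₁ + M₂)) (AdeleRing (𝓞 E) E)} {g₀ : GL (Fin (M₁ + M₂)) E}
  (hgg₀ : (g : Matrix (Fin (M₁ + M₂)) (Fin (M₁ + M₂)) (AdeleRing (𝓞 E) E)) =
    ((g₀ : GL (Fin (M₁ + M₂)) E) : Matrix (Fin (M₁ + M₂)) (Fin (M₁ + M₂)) E).map (algebraMap E (AdeleRing (𝓞 E) E)))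
  (hg : ((g : Matrix (Fin (M₁ + M₂)) (Fin (M₁ + M₂)) (AdeleRing (𝓞 E) E)).map (conjAdele F E c))ᵀ *
      adelicForm E (M₁ + M₂) JW * g = adelicForm E (M₁ + M₂) (finSum M₁ M₂ J₁ J₂))
  {C : GL (Fin N × Fin (M₁ + M₂)) (AdeleRing (𝓞 F) F)} {C₀ : GL (Fin N × Fin (M₁ + M₂)) F}
  (hCC₀ : (C : Matrix (Fin N × Fin (M₁ + M₂)) (Fin N × Fin (M₁ + M₂)) (AdeleRing (𝓞 F) F)) =
    ((C₀ : GL (Fin N × Fin (M₁ + M₂)) F) : Matrix (Fin N × Fin (M₁ + M₂)) (Fin N × Fin (M₁ + M₂)) F).map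
      (algebraMap F (AdeleRing (𝓞 F) F)))
  (hC : TV.map (algebraMap F (AdeleRing (𝓞 F) F)) ⊗ₖ TW.map (algebraMap F (AdeleRing (𝓞 F) F)) *
      (C : Matrix (Fin N × Fin (M₁ + M₂)) (Fin N × Fin (M₁ + M₂)) (AdeleRing (𝓞 F) F)) =
    TV.map (algebraMap F (AdeleRing (𝓞 F) F)) ⊗ₖ (finSum M₁ M₂ T₁ T₂).map (algebraMap F (AdeleRing (𝓞 F) F)))

/-- **the adelic see-saw element of this data** (unitary-2's `adelicSeesawConj` for `J_W′ = J₁ ⊕ᶠ J₂`; reducible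
abbreviation). [cite: Kudla1984, §1] -/
abbrev seesawElement :
    symplecticGroup (polar (adelicForm F (Fin N × Fin (M₁ + M₂))
      (TV.map (algebraMap F (AdeleRing (𝓞 F) F)) ⊗ₖ TW.map (algebraMap F (AdeleRing (𝓞 F) F))))) :=
  adelicSeesawConj F E c N (M₁ + M₂) hcδ hδ hd hV hW (isSymm_finSum h₁ h₂) hJV hJW
    (finSum_eq_map_finSum F E M₁ M₂ J₁ J₂ hJ₁ hJ₂) g hg C hC

include hVd hTWd hgg₀ hCC₀ in
/-- the see-saw element of rational data is `F`-rational (unitary-2's `adelicSeesawConj_mem_range`).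
[cite: GelbartRogawski1991, §3.1 p. 455] -/
theorem seesawElement_mem_range :
    seesawElement F E c N M₁ M₂ JV JW J₁ J₂ hcδ hδ hd hV hW h₁ h₂ hJV hJW hJ₁ hJ₂ hg hC ∈
      ((transportSp (TV.map (algebraMap F (AdeleRing (𝓞 F) F)) ⊗ₖ TW.map (algebraMap F (AdeleRing (𝓞 F) F))) hT).comp
        (mapHom (algebraMap F (AdeleRing (𝓞 F) F)))).range :=
  adelicSeesawConj_mem_range F E c N (M₁ + M₂) hcδ hδ hd hV hW (isSymm_finSum h₁ h₂) hVd hTWd hT hJV hJW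
    (finSum_eq_map_finSum F E M₁ M₂ J₁ J₂ hJ₁ hJ₂) hgg₀ hg hCC₀ hC

include hVd hTWd hT hgg₀ hCC₀ in
/-- **THE BIG SPLITTING CONJUGATED BY WEIL'S RATIONAL LIFT OF THE SEE-SAW ELEMENT**:
`ratConjSplitting … h₀ hrat C hC (seesawBigConj s g hg) : P →* Mp_ψ(W_{T_V ⊗ (T₁ ⊕ᶠ T₂)})ᶜᵒⁿᵗ` with
`h₀ := seesawElement … = adelicSeesawConj …` and `hrat := seesawElement_mem_range …`.
(cf. S. Kudla (1984) §1; A. Weil (1964) n° 40) [folklore] -/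
def seesawConjSplitting :
    adelic F E c N JV × (adelic F E c M₁ J₁ × adelic F E c M₂ J₂) →*
      adelicMpCont F (Fin N × Fin (M₁ + M₂))
        (TV.map (algebraMap F (AdeleRing (𝓞 F) F)) ⊗ₖ (finSum M₁ M₂ T₁ T₂).map (algebraMap F (AdeleRing (𝓞 F) F))) :=
  ratConjSplitting F (Fin N × Fin (M₁ + M₂)) hT
    (seesawElement F E c N M₁ M₂ JV JW J₁ J₂ hcδ hδ hd hV hW h₁ h₂ hJV hJW hJ₁ hJ₂ hg hC)
    (seesawElement_mem_range F E c N M₁ M₂ JV JW J₁ J₂ hcδ hδ hd hV hW h₁ h₂ hVd hTWd hT hJV hJW hJ₁ hJ₂ hgg₀ hg hCC₀ hC)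
    C hC (seesawBigConj F E c N M₁ M₂ eW JV JW J₁ J₂ s g hg)

/-- Unfolding. [folklore] -/
theorem seesawConjSplitting_def :
    seesawConjSplitting F E c N M₁ M₂ eW JV JW J₁ J₂ hcδ hδ hd hV hW h₁ h₂ hVd hTWd hT hJV hJW hJ₁ hJ₂ hgg₀ hg hCC₀ hC
        (s := s) =
      ratConjSplitting F (Fin N × Fin (M₁ + M₂)) hT
        (seesawElement F E c N M₁ M₂ JV JW J₁ J₂ hcδ hδ hd hV hW h₁ h₂ hJV hJW hJ₁ hJ₂ hg hC)
        (seesawElement_mem_range F E c N M₁ M₂ JV JW J₁ J₂ hcδ hδ hd hV hW h₁ h₂ hVd hTWd hT hJV hJW hJ₁ hJ₂ hgg₀ hg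
          hCC₀ hC)
        C hC (seesawBigConj F E c N M₁ M₂ eW JV JW J₁ J₂ s g hg) :=
  rfl

/-- **the square feeding the seam lemma**, in the currency of `AdelicMetaplecticSeesawConjugate` (`relabelVec`):
`h₀ · Congr_{Λ_C}(ι_{V,W₁⊕W₂}(v ⊗ (u₁ ⊕ᶠ u₂))) · h₀⁻¹ = π(seesawBigConj s g hg (v, (u₁, u₂)))` — unitary-2's
`adelicSeesawConj_conj` chained with `proj_seesawBigConj`. [cite: Kudla1984, §1] -/
theorem hsq_seesawConj
    (hs : (splittingDatum F E c N (M₁ + M₂) eW JV JW hcδ hδ hd hV hW hVd hTWd hJV hJW).IsCompatible s)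
    (q : adelic F E c N JV × (adelic F E c M₁ J₁ × adelic F E c M₂ J₂)) :
    seesawElement F E c N M₁ M₂ JV JW J₁ J₂ hcδ hδ hd hV hW h₁ h₂ hJV hJW hJ₁ hJ₂ hg hC *
        symplecticGroupCongr _ _ (relabelVec F (Fin N × Fin (M₁ + M₂)) C)
          (polar_relabelVec F (Fin N × Fin (M₁ + M₂)) C hC)
          (adelicPairToSymplectic F E c N (M₁ + M₂) hcδ hδ hd hV (isSymm_finSum h₁ h₂) hJV
            (finSum_eq_map_finSum F E M₁ M₂ J₁ J₂ hJ₁ hJ₂)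
            (dualPair (conjAdele F E c) (adelicForm E N JV) (adelicForm E (M₁ + M₂) (finSum M₁ M₂ J₁ J₂))
              (q.1, adelicBlockDiag F E c M₁ M₂ J₁ J₂ q.2))) *
      (seesawElement F E c N M₁ M₂ JV JW J₁ J₂ hcδ hδ hd hV hW h₁ h₂ hJV hJW hJ₁ hJ₂ hg hC)⁻¹ =
    adelicMpCont.proj F (Fin N × Fin (M₁ + M₂))
      (TV.map (algebraMap F (AdeleRing (𝓞 F) F)) ⊗ₖ TW.map (algebraMap F (AdeleRing (𝓞 F) F)))
      (seesawBigConj F E c N M₁ M₂ eW JV JW J₁ J₂ s g hg q) :=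
  (adelicSeesawConj_conj F E c N (M₁ + M₂) hcδ hδ hd hV hW (isSymm_finSum h₁ h₂) hJV hJW
      (finSum_eq_map_finSum F E M₁ M₂ J₁ J₂ hJ₁ hJ₂) g hg C hC q.1 (adelicBlockDiag F E c M₁ M₂ J₁ J₂ q.2)).trans
    (proj_seesawBigConj F E c N M₁ M₂ eW JV JW J₁ J₂ hcδ hδ hd hV hW hVd hTWd hJV hJW g hg hs q).symm

/-- **`π(seesawConjSplitting p) = ι_{V,W₁ ⊕ W₂}(v ⊗ (u₁ ⊕ᶠ u₂))`** — the seam lemma `proj_ratConjSplitting_eq` fed with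
`hsq_seesawConj`. [cite: Kudla1984, §1] -/
theorem proj_seesawConjSplitting
    (hs : (splittingDatum F E c N (M₁ + M₂) eW JV JW hcδ hδ hd hV hW hVd hTWd hJV hJW).IsCompatible s)
    (p : adelic F E c N JV × (adelic F E c M₁ J₁ × adelic F E c M₂ J₂)) :
    adelicMpCont.proj F (Fin N × Fin (M₁ + M₂))
        (TV.map (algebraMap F (AdeleRing (𝓞 F) F)) ⊗ₖ (finSum M₁ M₂ T₁ T₂).map (algebraMap F (AdeleRing (𝓞 F) F)))
        (seesawConjSplitting F E c N M₁ M₂ eW JV JW J₁ J₂ hcδ hδ hd hV hW h₁ h₂ hVd hTWd hT hJV hJW hJ₁ hJ₂ hgg₀ hg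
          hCC₀ hC (s := s) p) =
      adelicPairToSymplectic F E c N (M₁ + M₂) hcδ hδ hd hV (isSymm_finSum h₁ h₂) hJV
        (finSum_eq_map_finSum F E M₁ M₂ J₁ J₂ hJ₁ hJ₂)
        (dualPair (conjAdele F E c) (adelicForm E N JV) (adelicForm E (M₁ + M₂) (finSum M₁ M₂ J₁ J₂))
          (p.1, adelicBlockDiag F E c M₁ M₂ J₁ J₂ p.2)) :=
  proj_ratConjSplitting_eq F (Fin N × Fin (M₁ + M₂)) hT
    (seesawElement F E c N M₁ M₂ JV JW J₁ J₂ hcδ hδ hd hV hW h₁ h₂ hJV hJW hJ₁ hJ₂ hg hC)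
    (seesawElement_mem_range F E c N M₁ M₂ JV JW J₁ J₂ hcδ hδ hd hV hW h₁ h₂ hVd hTWd hT hJV hJW hJ₁ hJ₂ hgg₀ hg
      hCC₀ hC)
    C hC (seesawBigConj F E c N M₁ M₂ eW JV JW J₁ J₂ s g hg)
    (fun q => adelicPairToSymplectic F E c N (M₁ + M₂) hcδ hδ hd hV (isSymm_finSum h₁ h₂) hJV
      (finSum_eq_map_finSum F E M₁ M₂ J₁ J₂ hJ₁ hJ₂)
      (dualPair (conjAdele F E c) (adelicForm E N JV) (adelicForm E (M₁ + M₂) (finSum M₁ M₂ J₁ J₂))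
        (q.1, adelicBlockDiag F E c M₁ M₂ J₁ J₂ q.2)))
    (hsq_seesawConj F E c N M₁ M₂ eW JV JW J₁ J₂ hcδ hδ hd hV hW h₁ h₂ hVd hTWd hJV hJW hJ₁ hJ₂ hg hC hs) p

/-- **`Θ`-fixing at rational points** for the conjugated splitting (`r_F(h₀)` is `Θ`-fixing).
[cite: Weil1964, Chap. III n° 41 Thm 6 p. 193] -/
theorem coe_seesawConjSplitting_mem_adelicMpTheta
    (hs : (splittingDatum F E c N (M₁ + M₂) eW JV JW hcδ hδ hd hV hW hVd hTWd hJV hJW).IsCompatible s)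
    (hg₀ : (((g₀ : GL (Fin (M₁ + M₂)) E) : Matrix (Fin (M₁ + M₂)) (Fin (M₁ + M₂)) E).map (c : E →+* E))ᵀ * JW * g₀ =
      finSum M₁ M₂ J₁ J₂)
    (γV : rational F E c N JV) (γ₁ : rational F E c M₁ J₁) (γ₂ : rational F E c M₂ J₂) :
    ((seesawConjSplitting F E c N M₁ M₂ eW JV JW J₁ J₂ hcδ hδ hd hV hW h₁ h₂ hVd hTWd hT hJV hJW hJ₁ hJ₂ hgg₀ hg
          hCC₀ hC (s := s) (toAdelic F E c N JV γV, (toAdelic F E c M₁ J₁ γ₁, toAdelic F E c M₂ J₂ γ₂)) :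
        adelicMpCont F (Fin N × Fin (M₁ + M₂))
          (TV.map (algebraMap F (AdeleRing (𝓞 F) F)) ⊗ₖ (finSum M₁ M₂ T₁ T₂).map (algebraMap F (AdeleRing (𝓞 F) F)))) :
        adelicMp F (Fin N × Fin (M₁ + M₂))
          (TV.map (algebraMap F (AdeleRing (𝓞 F) F)) ⊗ₖ (finSum M₁ M₂ T₁ T₂).map (algebraMap F (AdeleRing (𝓞 F) F)))) ∈
      adelicMpTheta F (Fin N × Fin (M₁ + M₂))
        (TV.map (algebraMap F (AdeleRing (𝓞 F) F)) ⊗ₖ (finSum M₁ M₂ T₁ T₂).map (algebraMap F (AdeleRing (𝓞 F) F))) :=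
  (coe_ratConjSplitting_mem_adelicMpTheta_iff F (Fin N × Fin (M₁ + M₂)) hT
      (seesawElement F E c N M₁ M₂ JV JW J₁ J₂ hcδ hδ hd hV hW h₁ h₂ hJV hJW hJ₁ hJ₂ hg hC)
      (seesawElement_mem_range F E c N M₁ M₂ JV JW J₁ J₂ hcδ hδ hd hV hW h₁ h₂ hVd hTWd hT hJV hJW hJ₁ hJ₂ hgg₀ hg
        hCC₀ hC)
      C hC (seesawBigConj F E c N M₁ M₂ eW JV JW J₁ J₂ s g hg) _).2
    (coe_seesawBigConj_mem_adelicMpTheta F E c N M₁ M₂ eW JV JW J₁ J₂ hcδ hδ hd hV hW hVd hTWd hJV hJW g hg hs g₀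
      hg₀ hgg₀ γV γ₁ γ₂)

/-- **THE SEE-SAW HYPOTHESIS `hS` for the conjugated torus** (read through `finProdSumEquiv N M₁ M₂`):
`π(seesawConjSplitting p) = π(seesawSmall₁ s₁ p) ⊕ π(seesawSmall₂ s₂ p)` — unitary-2's
`adelicPairToSymplectic_dualPair_adelicBlockDiag` after `proj_seesawConjSplitting`. [cite: Kudla1984, §1] -/
theorem hS_seesawConj
    (hs : (splittingDatum F E c N (M₁ + M₂) eW JV JW hcδ hδ hd hV hW hVd hTWd hJV hJW).IsCompatible s)
    (hs₁ : (splittingDatum F E c N M₁ e₁ JV J₁ hcδ hδ hd hV h₁ hVd h₁d hJV hJ₁).IsCompatible s₁)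
    (hs₂ : (splittingDatum F E c N M₂ e₂ JV J₂ hcδ hδ hd hV h₂ hVd h₂d hJV hJ₂).IsCompatible s₂)
    (p : adelic F E c N JV × (adelic F E c M₁ J₁ × adelic F E c M₂ J₂)) :
    (spReindex (finProdSumEquiv N M₁ M₂)
        (TV.map (algebraMap F (AdeleRing (𝓞 F) F)) ⊗ₖ (finSum M₁ M₂ T₁ T₂).map (algebraMap F (AdeleRing (𝓞 F) F)))
        (adelicMpCont.proj F (Fin N × Fin (M₁ + M₂))
          (TV.map (algebraMap F (AdeleRing (𝓞 F) F)) ⊗ₖ (finSum M₁ M₂ T₁ T₂).map (algebraMap F (AdeleRing (𝓞 F) F)))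
          (seesawConjSplitting F E c N M₁ M₂ eW JV JW J₁ J₂ hcδ hδ hd hV hW h₁ h₂ hVd hTWd hT hJV hJW hJ₁ hJ₂ hgg₀ hg
            hCC₀ hC (s := s) p))).1 =
      (spSum (TV.map (algebraMap F (AdeleRing (𝓞 F) F)) ⊗ₖ T₁.map (algebraMap F (AdeleRing (𝓞 F) F)))
        (TV.map (algebraMap F (AdeleRing (𝓞 F) F)) ⊗ₖ T₂.map (algebraMap F (AdeleRing (𝓞 F) F)))
        (adelicMpCont.proj F (Fin N × Fin M₁)
            (TV.map (algebraMap F (AdeleRing (𝓞 F) F)) ⊗ₖ T₁.map (algebraMap F (AdeleRing (𝓞 F) F)))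
            (seesawSmall₁ F E c N M₁ M₂ e₁ JV J₁ J₂ s₁ p),
          adelicMpCont.proj F (Fin N × Fin M₂)
            (TV.map (algebraMap F (AdeleRing (𝓞 F) F)) ⊗ₖ T₂.map (algebraMap F (AdeleRing (𝓞 F) F)))
            (seesawSmall₂ F E c N M₁ M₂ e₂ JV J₁ J₂ s₂ p))).1 :=
  ((congrArg (fun x => (spReindex (finProdSumEquiv N M₁ M₂)
      (TV.map (algebraMap F (AdeleRing (𝓞 F) F)) ⊗ₖ (finSum M₁ M₂ T₁ T₂).map (algebraMap F (AdeleRing (𝓞 F) F))) x).1)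
      (proj_seesawConjSplitting F E c N M₁ M₂ eW JV JW J₁ J₂ hcδ hδ hd hV hW h₁ h₂ hVd hTWd hT hJV hJW hJ₁ hJ₂ hgg₀
        hg hCC₀ hC hs p)).trans
    (adelicPairToSymplectic_dualPair_adelicBlockDiag F E c N M₁ M₂ hcδ hδ hd hV h₁ h₂ hJV hJ₁ hJ₂ p.1 p.2)).trans
    (congrArg₂ (fun x y => (spSum (TV.map (algebraMap F (AdeleRing (𝓞 F) F)) ⊗ₖ T₁.map (algebraMap F (AdeleRing (𝓞 F) F)))
        (TV.map (algebraMap F (AdeleRing (𝓞 F) F)) ⊗ₖ T₂.map (algebraMap F (AdeleRing (𝓞 F) F))) (x, y)).1)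
      (proj_seesawSmall₁ F E c N M₁ M₂ e₁ JV J₁ J₂ hcδ hδ hd hV h₁ hVd h₁d hJV hJ₁ hs₁ p).symm
      (proj_seesawSmall₂ F E c N M₁ M₂ e₂ JV J₁ J₂ hcδ hδ hd hV h₂ hVd h₂d hJV hJ₂ hs₂ p).symm)

/-! ## §3 The character of the conjugated torus -/

/-- **THE `(34)` SEE-SAW CHARACTER AT THE SPLITTING DATA OF RECORD**
`χ₃₄ : U(J_V)(𝔸) × (U(J₁)(𝔸) × U(J₂)(𝔸)) →* ℂˣ` for the torus `g (U(J₁) × U(J₂)) g⁻¹ ⊂ U(J_W)`: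
`mpSeesawCharSum` along `finProdSumEquiv N M₁ M₂` of `seesawConjSplitting` against `seesawSmall₁ s₁`, `seesawSmall₂ s₂`.
(cf. R. Howe (1979) §3; S. Kudla (1984) §1; S. Gelbart–J. Rogawski (1991) §3.1 Remark p. 457) [folklore] -/
def mpSeesawChar₃₄
    (hs : (splittingDatum F E c N (M₁ + M₂) eW JV JW hcδ hδ hd hV hW hVd hTWd hJV hJW).IsCompatible s)
    (hs₁ : (splittingDatum F E c N M₁ e₁ JV J₁ hcδ hδ hd hV h₁ hVd h₁d hJV hJ₁).IsCompatible s₁)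
    (hs₂ : (splittingDatum F E c N M₂ e₂ JV J₂ hcδ hδ hd hV h₂ hVd h₂d hJV hJ₂).IsCompatible s₂) :
    adelic F E c N JV × (adelic F E c M₁ J₁ × adelic F E c M₂ J₂) →* ℂˣ :=
  mpSeesawCharSum (finProdSumEquiv N M₁ M₂) (reindex_gram_finSum F N M₁ M₂)
    (seesawConjSplitting F E c N M₁ M₂ eW JV JW J₁ J₂ hcδ hδ hd hV hW h₁ h₂ hVd hTWd hT hJV hJW hJ₁ hJ₂ hgg₀ hg hCC₀ hC
      (s := s))
    (seesawSmall₁ F E c N M₁ M₂ e₁ JV J₁ J₂ s₁) (seesawSmall₂ F E c N M₁ M₂ e₂ JV J₁ J₂ s₂)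
    (hS_seesawConj F E c N M₁ M₂ eW e₁ e₂ JV JW J₁ J₂ hcδ hδ hd hV hW h₁ h₂ hVd hTWd h₁d h₂d hT hJV hJW hJ₁ hJ₂ hgg₀
      hg hCC₀ hC hs hs₁ hs₂)
    (isUnit_kronecker_map F N hVd h₁d) (isUnit_kronecker_map F N hVd h₂d)

/-- By definition `mpSeesawChar₃₄ … = mpSeesawCharSum (finProdSumEquiv N M₁ M₂) _ (seesawConjSplitting …) (seesawSmall₁ s₁)
(seesawSmall₂ s₂) …`. [folklore] -/
theorem mpSeesawChar₃₄_def
    (hs : (splittingDatum F E c N (M₁ + M₂) eW JV JW hcδ hδ hd hV hW hVd hTWd hJV hJW).IsCompatible s)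
    (hs₁ : (splittingDatum F E c N M₁ e₁ JV J₁ hcδ hδ hd hV h₁ hVd h₁d hJV hJ₁).IsCompatible s₁)
    (hs₂ : (splittingDatum F E c N M₂ e₂ JV J₂ hcδ hδ hd hV h₂ hVd h₂d hJV hJ₂).IsCompatible s₂) :
    mpSeesawChar₃₄ F E c N M₁ M₂ eW e₁ e₂ JV JW J₁ J₂ hcδ hδ hd hV hW h₁ h₂ hVd hTWd h₁d h₂d hT hJV hJW hJ₁ hJ₂ hgg₀
        hg hCC₀ hC hs hs₁ hs₂ =
      mpSeesawCharSum (finProdSumEquiv N M₁ M₂) (reindex_gram_finSum F N M₁ M₂)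
        (seesawConjSplitting F E c N M₁ M₂ eW JV JW J₁ J₂ hcδ hδ hd hV hW h₁ h₂ hVd hTWd hT hJV hJW hJ₁ hJ₂ hgg₀ hg
          hCC₀ hC (s := s))
        (seesawSmall₁ F E c N M₁ M₂ e₁ JV J₁ J₂ s₁) (seesawSmall₂ F E c N M₁ M₂ e₂ JV J₁ J₂ s₂)
        (hS_seesawConj F E c N M₁ M₂ eW e₁ e₂ JV JW J₁ J₂ hcδ hδ hd hV hW h₁ h₂ hVd hTWd h₁d h₂d hT hJV hJW hJ₁ hJ₂
          hgg₀ hg hCC₀ hC hs hs₁ hs₂)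
        (isUnit_kronecker_map F N hVd h₁d) (isUnit_kronecker_map F N hVd h₂d) :=
  rfl

/-- **The identity in the transported model** (Gram `T_V ⊗ (T₁ ⊕ᶠ T₂) ⊗ 1`):
`ω(seesawConjSplitting p) (sumTensor Φ₁ Φ₂) = χ₃₄(p) • sumTensor (ω(seesawSmall₁ s₁ p) Φ₁) (ω(seesawSmall₂ s₂ p) Φ₂)`. [folklore] -/
theorem mpSeesawChar₃₄_spec_transported
    (hs : (splittingDatum F E c N (M₁ + M₂) eW JV JW hcδ hδ hd hV hW hVd hTWd hJV hJW).IsCompatible s)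
    (hs₁ : (splittingDatum F E c N M₁ e₁ JV J₁ hcδ hδ hd hV h₁ hVd h₁d hJV hJ₁).IsCompatible s₁)
    (hs₂ : (splittingDatum F E c N M₂ e₂ JV J₂ hcδ hδ hd hV h₂ hVd h₂d hJV hJ₂).IsCompatible s₂)
    (p : adelic F E c N JV × (adelic F E c M₁ J₁ × adelic F E c M₂ J₂))
    (Φ₁ : piSchwartzBruhat F (Fin N × Fin M₁)) (Φ₂ : piSchwartzBruhat F (Fin N × Fin M₂)) :
    adelicMpCont.omega F (Fin N × Fin (M₁ + M₂))
        (TV.map (algebraMap F (AdeleRing (𝓞 F) F)) ⊗ₖ (finSum M₁ M₂ T₁ T₂).map (algebraMap F (AdeleRing (𝓞 F) F)))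
        (seesawConjSplitting F E c N M₁ M₂ eW JV JW J₁ J₂ hcδ hδ hd hV hW h₁ h₂ hVd hTWd hT hJV hJW hJ₁ hJ₂ hgg₀ hg
          hCC₀ hC (s := s) p) (sumTensor F (finProdSumEquiv N M₁ M₂) Φ₁ Φ₂) =
      (mpSeesawChar₃₄ F E c N M₁ M₂ eW e₁ e₂ JV JW J₁ J₂ hcδ hδ hd hV hW h₁ h₂ hVd hTWd h₁d h₂d hT hJV hJW hJ₁ hJ₂ hgg₀
          hg hCC₀ hC hs hs₁ hs₂ p : ℂ) •
        sumTensor F (finProdSumEquiv N M₁ M₂)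
          (adelicMpCont.omega F (Fin N × Fin M₁)
            (TV.map (algebraMap F (AdeleRing (𝓞 F) F)) ⊗ₖ T₁.map (algebraMap F (AdeleRing (𝓞 F) F)))
            (seesawSmall₁ F E c N M₁ M₂ e₁ JV J₁ J₂ s₁ p) Φ₁)
          (adelicMpCont.omega F (Fin N × Fin M₂)
            (TV.map (algebraMap F (AdeleRing (𝓞 F) F)) ⊗ₖ T₂.map (algebraMap F (AdeleRing (𝓞 F) F)))
            (seesawSmall₂ F E c N M₁ M₂ e₂ JV J₁ J₂ s₂ p) Φ₂) :=
  mpSeesawCharSum_spec (finProdSumEquiv N M₁ M₂) (reindex_gram_finSum F N M₁ M₂) _ _ _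
    (hS_seesawConj F E c N M₁ M₂ eW e₁ e₂ JV JW J₁ J₂ hcδ hδ hd hV hW h₁ h₂ hVd hTWd h₁d h₂d hT hJV hJW hJ₁ hJ₂ hgg₀
      hg hCC₀ hC hs hs₁ hs₂) _ _ p Φ₁ Φ₂

/-- **THE `(34)` RESTRICTION IDENTITY IN THE BIG PAIR'S OWN MODEL** (Gram `T_V ⊗ T_W ⊗ 1`, Kronecker coordinates):
with `r := r_F(h₀)` Weil's `Θ`-fixing lift of the see-saw element,
`ω(s_pair(v, g (u₁ ⊕ᶠ u₂) g⁻¹)) (ω(r) (sumTensor Φ₁ Φ₂)) = χ₃₄(p) • ω(r) (sumTensor (ω(seesawSmall₁ s₁ p) Φ₁) (ω(seesawSmall₂ s₂ p) Φ₂))`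
(the big splitting read back along `e_W`). (cf. S. Kudla (1984) §1; R. Howe (1979) §3) [folklore] -/
theorem mpSeesawChar₃₄_spec
    (hs : (splittingDatum F E c N (M₁ + M₂) eW JV JW hcδ hδ hd hV hW hVd hTWd hJV hJW).IsCompatible s)
    (hs₁ : (splittingDatum F E c N M₁ e₁ JV J₁ hcδ hδ hd hV h₁ hVd h₁d hJV hJ₁).IsCompatible s₁)
    (hs₂ : (splittingDatum F E c N M₂ e₂ JV J₂ hcδ hδ hd hV h₂ hVd h₂d hJV hJ₂).IsCompatible s₂)
    (p : adelic F E c N JV × (adelic F E c M₁ J₁ × adelic F E c M₂ J₂))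
    (Φ₁ : piSchwartzBruhat F (Fin N × Fin M₁)) (Φ₂ : piSchwartzBruhat F (Fin N × Fin M₂)) :
    adelicMpCont.omega F (Fin N × Fin (M₁ + M₂))
        (TV.map (algebraMap F (AdeleRing (𝓞 F) F)) ⊗ₖ TW.map (algebraMap F (AdeleRing (𝓞 F) F)))
        (seesawBigConj F E c N M₁ M₂ eW JV JW J₁ J₂ s g hg p)
        (adelicMpCont.omega F (Fin N × Fin (M₁ + M₂))
          (TV.map (algebraMap F (AdeleRing (𝓞 F) F)) ⊗ₖ TW.map (algebraMap F (AdeleRing (𝓞 F) F)))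
          (ratPointsThetaLiftCont F (Fin N × Fin (M₁ + M₂)) _ hT
            ⟨seesawElement F E c N M₁ M₂ JV JW J₁ J₂ hcδ hδ hd hV hW h₁ h₂ hJV hJW hJ₁ hJ₂ hg hC,
              seesawElement_mem_range F E c N M₁ M₂ JV JW J₁ J₂ hcδ hδ hd hV hW h₁ h₂ hVd hTWd hT hJV hJW hJ₁ hJ₂ hgg₀
                hg hCC₀ hC⟩)
          (sumTensor F (finProdSumEquiv N M₁ M₂) Φ₁ Φ₂)) =
      (mpSeesawChar₃₄ F E c N M₁ M₂ eW e₁ e₂ JV JW J₁ J₂ hcδ hδ hd hV hW h₁ h₂ hVd hTWd h₁d h₂d hT hJV hJW hJ₁ hJ₂ hgg₀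
          hg hCC₀ hC hs hs₁ hs₂ p : ℂ) •
        adelicMpCont.omega F (Fin N × Fin (M₁ + M₂))
          (TV.map (algebraMap F (AdeleRing (𝓞 F) F)) ⊗ₖ TW.map (algebraMap F (AdeleRing (𝓞 F) F)))
          (ratPointsThetaLiftCont F (Fin N × Fin (M₁ + M₂)) _ hT
            ⟨seesawElement F E c N M₁ M₂ JV JW J₁ J₂ hcδ hδ hd hV hW h₁ h₂ hJV hJW hJ₁ hJ₂ hg hC,
              seesawElement_mem_range F E c N M₁ M₂ JV JW J₁ J₂ hcδ hδ hd hV hW h₁ h₂ hVd hTWd hT hJV hJW hJ₁ hJ₂ hgg₀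
                hg hCC₀ hC⟩)
          (sumTensor F (finProdSumEquiv N M₁ M₂)
            (adelicMpCont.omega F (Fin N × Fin M₁)
              (TV.map (algebraMap F (AdeleRing (𝓞 F) F)) ⊗ₖ T₁.map (algebraMap F (AdeleRing (𝓞 F) F)))
              (seesawSmall₁ F E c N M₁ M₂ e₁ JV J₁ J₂ s₁ p) Φ₁)
            (adelicMpCont.omega F (Fin N × Fin M₂)
              (TV.map (algebraMap F (AdeleRing (𝓞 F) F)) ⊗ₖ T₂.map (algebraMap F (AdeleRing (𝓞 F) F)))
              (seesawSmall₂ F E c N M₁ M₂ e₂ JV J₁ J₂ s₂ p) Φ₂)) :=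
  ((omega_apply_omega_ratConjSplitting F (Fin N × Fin (M₁ + M₂)) hT
      (seesawElement F E c N M₁ M₂ JV JW J₁ J₂ hcδ hδ hd hV hW h₁ h₂ hJV hJW hJ₁ hJ₂ hg hC)
      (seesawElement_mem_range F E c N M₁ M₂ JV JW J₁ J₂ hcδ hδ hd hV hW h₁ h₂ hVd hTWd hT hJV hJW hJ₁ hJ₂ hgg₀ hg
        hCC₀ hC)
      C hC (seesawBigConj F E c N M₁ M₂ eW JV JW J₁ J₂ s g hg) p
      (sumTensor F (finProdSumEquiv N M₁ M₂) Φ₁ Φ₂)).symm.trans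
    (congrArg (adelicMpCont.omega F (Fin N × Fin (M₁ + M₂))
        (TV.map (algebraMap F (AdeleRing (𝓞 F) F)) ⊗ₖ TW.map (algebraMap F (AdeleRing (𝓞 F) F))) _)
      (mpSeesawChar₃₄_spec_transported F E c N M₁ M₂ eW e₁ e₂ JV JW J₁ J₂ hcδ hδ hd hV hW h₁ h₂ hVd hTWd h₁d h₂d hT
        hJV hJW hJ₁ hJ₂ hgg₀ hg hCC₀ hC hs hs₁ hs₂ p Φ₁ Φ₂))).trans
    (LinearMap.map_smul _ _ _)

/-- **`χ₃₄ = 1` ON RATIONAL POINTS** (the three compatible splittings and `r_F(h₀)` are `Θ`-fixing at rational points: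
[GelbartRogawski1991, Remark p. 457] in kernel form for the conjugated torus). [cite: Weil1964, Chap. III n° 41 Thm 6 p. 193] -/
theorem mpSeesawChar₃₄_eq_one_of_rational
    (hs : (splittingDatum F E c N (M₁ + M₂) eW JV JW hcδ hδ hd hV hW hVd hTWd hJV hJW).IsCompatible s)
    (hs₁ : (splittingDatum F E c N M₁ e₁ JV J₁ hcδ hδ hd hV h₁ hVd h₁d hJV hJ₁).IsCompatible s₁)
    (hs₂ : (splittingDatum F E c N M₂ e₂ JV J₂ hcδ hδ hd hV h₂ hVd h₂d hJV hJ₂).IsCompatible s₂)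
    (hg₀ : (((g₀ : GL (Fin (M₁ + M₂)) E) : Matrix (Fin (M₁ + M₂)) (Fin (M₁ + M₂)) E).map (c : E →+* E))ᵀ * JW * g₀ =
      finSum M₁ M₂ J₁ J₂)
    (γV : rational F E c N JV) (γ₁ : rational F E c M₁ J₁) (γ₂ : rational F E c M₂ J₂) :
    mpSeesawChar₃₄ F E c N M₁ M₂ eW e₁ e₂ JV JW J₁ J₂ hcδ hδ hd hV hW h₁ h₂ hVd hTWd h₁d h₂d hT hJV hJW hJ₁ hJ₂ hgg₀
        hg hCC₀ hC hs hs₁ hs₂ (toAdelic F E c N JV γV, (toAdelic F E c M₁ J₁ γ₁, toAdelic F E c M₂ J₂ γ₂)) = 1 :=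
  mpSeesawCharSum_eq_one_of_mem_adelicMpTheta (finProdSumEquiv N M₁ M₂) (reindex_gram_finSum F N M₁ M₂) _ _ _
    (hS_seesawConj F E c N M₁ M₂ eW e₁ e₂ JV JW J₁ J₂ hcδ hδ hd hV hW h₁ h₂ hVd hTWd h₁d h₂d hT hJV hJW hJ₁ hJ₂ hgg₀
      hg hCC₀ hC hs hs₁ hs₂) _ _
    (coe_seesawConjSplitting_mem_adelicMpTheta F E c N M₁ M₂ eW JV JW J₁ J₂ hcδ hδ hd hV hW h₁ h₂ hVd hTWd hT hJV hJW
      hJ₁ hJ₂ hgg₀ hg hCC₀ hC hs hg₀ γV γ₁ γ₂)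
    (coe_seesawSmall₁_mem_adelicMpTheta F E c N M₁ M₂ e₁ JV J₁ J₂ hcδ hδ hd hV h₁ hVd h₁d hJV hJ₁ hs₁ γV γ₁ _)
    (coe_seesawSmall₂_mem_adelicMpTheta F E c N M₁ M₂ e₂ JV J₁ J₂ hcδ hδ hd hV h₂ hVd h₂d hJV hJ₂ hs₂ γV _ γ₂)

end Conj

/-! ### Build-lane note (ops-buildfix G11b-3 recipe, LEDGER B13-1, 2026-08-21)
`lean -o` (the hub build lane, never `lean`/the gate check) runs Lean 4.32's library-suggestion indexers
(`Lean.LibrarySuggestions.SymbolFrequency` / `SineQuaNon`, from their `exportEntriesFn`) over the statement of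
every local theorem that is not a denied premise; on this family's statements (very large dependent binder
telescopes through the theta-kernel / dual-pair data) that fold runs for tens of minutes to hours and the build
lane kills the job (incident G11b-3, run/shared/lean/ops/buildfix/G11b-3-DOSSIER.md). `isDeniedPremise` skips
`[implicit_reducible]` constants before any fold, and a reducibility status on a *theorem* is inert (Meta never
unfolds `thmInfo`; the kernel ignores the attribute), so the public theorems of this file are tagged
`[implicit_reducible]` purely to keep them out of that index. Only other effect: they are not offered by
`+suggestions` premise selectors. No statement or proof is changed; superseded if the operator lands a
deny-list form (`HarnessLib.PremiseIndex`). -/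
set_option allowUnsafeReducibility true in
attribute [implicit_reducible]
  seesawBigConj_apply omega_seesawBigConj_apply adelicIsometryConj_toAdelic
  adelicIsometryConj_toAdelic_mem_range proj_seesawBigConj coe_seesawBigConj_mem_adelicMpTheta
  seesawElement_mem_range seesawConjSplitting_def hsq_seesawConj proj_seesawConjSplitting
  coe_seesawConjSplitting_mem_adelicMpTheta hS_seesawConj mpSeesawChar₃₄_def
  mpSeesawChar₃₄_spec_transported mpSeesawChar₃₄_spec mpSeesawChar₃₄_eq_one_of_rational

end UnitaryDualPair

end Literature.NumberTheory.GelbartRogawski1991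

end
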